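import Mathlib
import HarnessLib
import Summits.HubbardSuperconductivity.HubbardSuperconductivity.Theorems.KLProgrammeKLRegimeSplitPredicatesV3
import Summits.HubbardSuperconductivity.HubbardSuperconductivity.Theorems.KLProgrammeKLRegimeSplitTwoLegF

/-!
# Route `KLProgramme` — crux K3 `KLRegimeTwoPointLimit` (stmt-HubbardSuperconductivity-19937): the predicate bundle VERSION 4,
# `klPredsV4 := { klPredsV3 with renorm := RenormalisedAtF, twoLeg := TwoLegStepV4 }` (cell gate-hubbard-kl, seat p2, g4)

WHY A V4 (HOME/STATUS p2 g4 2026-08-26 12:07Z, defects Δ8–Δ10; HOME/P2-C4B.md §9).  V3 (`…SplitPredicatesV3`, p1) repaired the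
`split` / `engine` slots; the three remaining slots are p2's v1 texts and two of them do not compose:

* `renorm = RenormalisedAt` (Part 1) carries a FIELD-STRENGTH clause `|z_n − 1| ≤ cz|U|` that child 2 must CONCLUDE at every scale
  for its frame, while no slot of V3 supplies anything about `Im Σ` / `fieldStrength` (Δ9) — `CountertermP klPredsV3 W` is
  unprovable as typed.  V4: `renorm := RenormalisedAtF` (local part ON THE FRAME'S FERMI CURVE within the QUADRATIC tolerance
  `cr|U|Λ_n²/e₀`, no `z`); the field strength becomes the ENGINE output (E3d) inside the two-leg slot.
* `twoLeg = TwoLegStep` (Part 2 v2) states (E3a–c) on the v1 pieces `klTwoLegPiece`, i.e. on the interpolant of the WILSONIAN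
  two-leg kernel over all lattice momenta, whose one-particle-reducible cutoff-overlap terms `(Im Σ^{1PI})²·w_n·e_K/(ω₀²+e_K²)` violate
  the (E3a) majorants by `≍ ω₀²/Λ_n³ ≥ β/(64π)` at the bottom scales for EVERY frame (Δ10) — the two-leg conjunct of
  `EngineP klPredsV3 W` is false.  V4: `twoLeg := TwoLegStepV4` = `TwoLegStepF` (the same (E3a–c) on the FERMI-CURVE-read pieces
  `klTwoLegPieceF` of `…SplitTwoLegF`, BGM's `ℒ`) with the comparison-frame history of (E3c) instantiated at THIS bundle's
  split/renorm/engine, plus (E3d/e) `TwoLegSlopes`.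
* the third (`frameOK = FrameOK`) is kept; the STAGING defect Δ8 (engine constants `Q` chosen before `R`) is repaired not in the
  bundle but in the children: the V4 children of record are the RESTAGED `EngineP2 | BetaSplitP | CountertermP2 | TwoPointAssemblyP
  klPredsV4 klWindowC` of `…SplitGenericV2`, glue-by `KLRegimeInductionV4 := KLRegimeInductionP2 klPredsV4` (`…SplitGlueV4`).

`split := BetaSplitAtV3` and `engine := EngineBoundsAtV3` are p1's V3 slots VERBATIM (their supplier map, `…SplitPredicatesV3` §doc, is
unchanged; p3's row 0′ and p1b's freezing/values modules bind them and are unaffected).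

SUPPLIER MAP, V4 additions (consumer ⇐ suppliers; owner):
| `RenormalisedAtF n` (every `n ≤ n_β`, child 2's ONE frame)   | fixed point of `T(K) = P(K) ⊖ D_N(K)`: (E3a-F) sizes Σ_n ⇒ self-map (`frameOK_counterterm`-type), (E3c-F) Σ_n `lipBar` ≤ ½ ⇒ contraction, tail Σ_{j>n} `twoLegBar 0 j` ⇒ quadratic tolerance | child 2 (p2) |
| (E3a-F)(E3b-F)(E3c-F) at `n`                                  | tree expansion of the scale-`n` step read through BGM's `ℒ` (local part on the curve; App. C floor) | child 3 (engine)      |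
| (E3d/e) `TwoLegSlopes n`                                       | second-order two-leg computations of the engine (`z − 1`, `∂_e Re Σ = O(U²)`), any `cz > 0` for `U ≤ U₀(R)` | child 3 (engine)      |
| engine's residual-mass inputs at `n` (two-leg vertex of `V_{n-1}` small on the slice) | `HistP`: `RenormalisedAtF (j<n)` + `TwoLegSlopes (j<n)` | child 3 hypothesis |
Definitions only; nothing is asserted about the model.
-/

noncomputable section

namespace Summit.HubbardSuperconductivity.HubbardSuperconductivity.Theorems.KLRegimeSplit

set_option linter.dupNamespace false -- summit = problem name (single-conjunct summit), D-0017

open Real Finset Literature.MathematicalPhysics.QuantumLattice Literature.Probability.LatticeModels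
open Summit.HubbardSuperconductivity.HubbardSuperconductivity.Theorems.KLProgrammeLegKernels

/-! ## §1 The V4 two-leg slot: `TwoLegStepF` at this bundle's history -/

section Model

variable (L M : ℕ) [NeZero L] [NeZero M]

/-- **The comparison-frame history of the V4 bundle** at scale `j` (what (E3c-F)'s `K′` is assumed to satisfy below `n`): V3's split
and engine output and the v2 renormalisation — `BetaSplitAtV3 ∧ RenormalisedAtF ∧ EngineBoundsAtV3` at `j`. -/
def histV4 (G : GeoConsts) (P : SplitConsts) (Q : EngConsts) (R : RenConsts) (β U μ : ℝ) : TrigPolyC4v → ℕ → Prop :=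
  fun K' j => BetaSplitAtV3 L M G P Q β U μ K' j ∧ RenormalisedAtF L M β U μ K' R j ∧ EngineBoundsAtV3 L M G P Q β U μ K' j

/-- **`TwoLegStepV4 … G P Q R K n`** := `TwoLegStepF` ((E3a-F) sizes ∧ (E3b-F) floor ∧ (E3c-F) frame-Lipschitz ∧ (E3d/e) slopes, on the
Fermi-curve-read pieces) with the comparison-frame history `histV4`.  Same slot type as `Preds.twoLeg`. -/
def TwoLegStepV4 (G : GeoConsts) (P : SplitConsts) (Q : EngConsts) (R : RenConsts) (β U μ : ℝ) (K : TrigPolyC4v) (n : ℕ) :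
    Prop :=
  TwoLegStepF L M (histV4 L M G P Q R β U μ) G P Q R β U μ K n

end Model

/-! ## §2 The V4 bundle -/

/-- **`klPredsV4 : Preds`** := `{ frameOK := FrameOK, renorm := RenormalisedAtF, split := BetaSplitAtV3, engine := EngineBoundsAtV3,
twoLeg := TwoLegStepV4 }` — V3 with p2's two slots replaced (Δ9/Δ10).  Children of record (restaged, Δ8):
`EngineP2 klPredsV4 klWindowC`, `BetaSplitP klPredsV4 klWindowC`, `CountertermP2 klPredsV4 klWindowC`,
`TwoPointAssemblyP klPredsV4 klWindowC` (`…SplitGenericV2`); glue line (downstream, `…SplitGlueV4`):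
`KLRegimeInductionV4 := KLRegimeInductionP2 klPredsV4`. -/
def klPredsV4 : Preds where
  frameOK := FrameOK
  renorm := fun L M _ _ β U μ K R n => RenormalisedAtF L M β U μ K R n
  split := fun L M _ _ G P Q β U μ K n => BetaSplitAtV3 L M G P Q β U μ K n
  engine := fun L M _ _ G P Q β U μ K n => EngineBoundsAtV3 L M G P Q β U μ K n
  twoLeg := fun L M _ _ G P Q R β U μ K n => TwoLegStepV4 L M G P Q R β U μ K n

/-! ## §3 Bookkeeping (`rfl`-level) -/

/-- V4's split slot IS V3's. -/
theorem klPredsV4_split : klPredsV4.split = klPredsV3.split := rfl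

/-- V4's engine slot IS V3's. -/
theorem klPredsV4_engine : klPredsV4.engine = klPredsV3.engine := rfl

/-- V4's frame class IS V3's (`FrameOK`). -/
theorem klPredsV4_frameOK : klPredsV4.frameOK = klPredsV3.frameOK := rfl

/-- V4's renormalisation slot is `RenormalisedAtF`. -/
theorem klPredsV4_renorm (L M : ℕ) [NeZero L] [NeZero M] (β U μ : ℝ) (K : TrigPolyC4v) (R : RenConsts) (n : ℕ) :
    klPredsV4.renorm L M β U μ K R n = RenormalisedAtF L M β U μ K R n := rfl

/-- V4's two-leg slot is `TwoLegStepV4`. -/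
theorem klPredsV4_twoLeg (L M : ℕ) [NeZero L] [NeZero M] (G : GeoConsts) (P : SplitConsts) (Q : EngConsts) (R : RenConsts)
    (β U μ : ℝ) (K : TrigPolyC4v) (n : ℕ) :
    klPredsV4.twoLeg L M G P Q R β U μ K n = TwoLegStepV4 L M G P Q R β U μ K n := rfl

/-- The V4 history at `j` unfolds to the three V4 slots at `j` (so `HistP klPredsV4 … n` gives `histV4 … K j` for `j < n`). -/
theorem histV4_of_histP {L M : ℕ} [NeZero L] [NeZero M] {G : GeoConsts} {P : SplitConsts} {Q : EngConsts} {R : RenConsts}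
    {β U μ : ℝ} {K : TrigPolyC4v} {n : ℕ} (h : HistP klPredsV4 L M G P Q R β U μ K n) :
    ∀ j < n, histV4 L M G P Q R β U μ K j := fun j hj =>
  ⟨(h j hj).1, (h j hj).2.1, (h j hj).2.2.1⟩

end Summit.HubbardSuperconductivity.HubbardSuperconductivity.Theorems.KLRegimeSplit

end
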